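import Mathlib
import HarnessLib
import Summits.HubbardSuperconductivity.HubbardSuperconductivity.Theorems.KLProgrammeKLRegimeSplitPhValueDiagonal
import Summits.HubbardSuperconductivity.HubbardSuperconductivity.Theorems.KLProgrammeKLRegimeSplitPhValueProfileRef
import Summits.HubbardSuperconductivity.HubbardSuperconductivity.Theorems.KLProgrammeKLRegimeSplitPhValueRowWeighted

/-!
# Route `KLProgramme` — ENGINE (stmt-HubbardSuperconductivity-20437 `KLRegimeEngineV17F2`), row (c) binder #8 (★ v19 `hexLadMV`), DIRECT row `RP` at the diagonal in the rows
# door's literal `hP` shape, θ-RESOLVED (corner-law) currency — O6f's collapse + window-profile moduli (O6e″) + angularly weighted rotation (O6i-c) in ONE statement — brick O6f′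
# (cell gate-hubbard-kl, seat hubbard-kl-k3c2-p2 g32, technique «thermal-bar induction n ≤ nScales β + 1 with EngineBoundsAtV4S sums»)

* **`klph_directRow_diag_le_weighted`** — `(Λₙ−Λₙ₊₁)((βL²)³)⁻¹·‖hP object at y = x‖ ≤ 2·((Λₙ−Λₙ₊₁)·2𝔅_w + 2¹⁰·15367·ε + Σ_w 2¹⁰·15381(ρ_w/π + 1/L)A_w)` for a reference
  field `V₀ p σ` with window-profile closeness to the kernel products on the hard shell and spin sum = an admissible angular weight `w₁(p_k̃) + i·w₂(p_k̃)` (weights from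
  `klpw_angularWeight_exists_frame` given the profile alone).  The E1 owner supplies: the profiles, the window data, nothing else.
Pure composition; no definitions; nothing asserts (c), K3 or superconductivity.  [cite: BenfattoGiulianiMastropietro2006, §2.4–§2.5]
-/

noncomputable section

namespace Summit.HubbardSuperconductivity.HubbardSuperconductivity.Theorems.KLRegimeSplit

set_option linter.dupNamespace false -- summit = problem name (single-conjunct summit), D-0017

open Real Set Finset Literature.MathematicalPhysics.QuantumLattice
open Literature.Probability.LatticeModels hiding torusSupNorm
open Literature.MathematicalPhysics.QuantumLattice.BandSectorCounting
open Summit.HubbardSuperconductivity.HubbardSuperconductivity.Theorems.TwoPointAssembly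
open Summit.HubbardSuperconductivity.HubbardSuperconductivity.Theorems.KLProgrammeLegKernels
open Summit.HubbardSuperconductivity.HubbardSuperconductivity.Theorems.KLRegimeWick
open Summit.HubbardSuperconductivity.HubbardSuperconductivity.Theorems.EngineV8
open Summit.HubbardSuperconductivity.HubbardSuperconductivity.Theorems.DispersionFlow
open Summit.HubbardSuperconductivity.HubbardSuperconductivity.Theorems.PerturbedFermiCurve
open Summit.HubbardSuperconductivity.HubbardSuperconductivity.Theorems.C4a

variable {L M : ℕ} [NeZero L] [NeZero M]

section DiagWeighted

variable {R : RenConsts} {U : ℝ} {N : ℕ}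

/-- **THE DIRECT p-h ROW AT THE DIAGONAL, IN THE ROWS DOOR'S LITERAL SHAPE.**  Under the hypotheses of `klph_phValue_row_le_of_moduli` (C4a chart for the rotation part,
`FrameOK`/`klBetaMin ≤ β ≤ L`/`j ≥ n+1` for the masses), for any kernel product `F`, a reference field `V₀ p σ` with window-profile closeness on the hard shell and spin sum an
admissible angular weight: `(Λₙ−Λₙ₊₁)((βL²)³)⁻¹·‖hP object at y = x‖ ≤ 2·((Λₙ−Λₙ₊₁)·2𝔅_w + 2¹⁰·15367·ε + Σ_w 2¹⁰·15381(ρ_w/π + 1/L)A_w)` (θ-resolved twin of O6f).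
[cite: BenfattoGiulianiMastropietro2006, §2.4–§2.5] -/
theorem klph_directRow_diag_le_weighted {β μ : ℝ} {K : TrigPolyC4v} (hK : FrameOK R U N μ K) (hβ : klBetaMin ≤ β) (hβL : β ≤ L)
    {a b : ℝ} (B : BandBounds a b) {A : ℝ} (hA : ∀ p : Momentum, ∀ j ≤ 2, ‖iteratedFDeriv ℝ j (frameShift K) p‖ ≤ A) (hADt : 2 * A < B.Dtmin)
    {r : ℝ} (hlo : a < μ - r - A) (hhi : μ + r + A < b) (n : ℕ) {t : ℝ} (ht : t ∈ Icc (0 : ℝ) 1)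
    (Φ : ℕ → ℝ → FreqMomentum L M → ℝ) (hΦ : Φ = fun j t k => (softSymbolCompl L M β μ K (n + 1) j) k + (hubbardCutoffWeightCT L M β μ K (klScale klE0 (n + 1)) k -
            hubbardCutoffWeightCT L M β μ K (klScale klE0 n + t * (klScale klE0 (n + 1) - klScale klE0 n)) k))
    (Wd : ℝ → FreqMomentum L M → ℝ) (hWd : Wd = fun t k => deriv (fun Λ' : ℝ => hubbardCutoffWeightCT L M β μ K Λ' k) (klScale klE0 n + t * (klScale klE0 (n + 1) - klScale klE0 n)))
    {j : ℕ} (hj : n + 1 ≤ j) (hΛr : klScale klE0 n + t * (klScale klE0 (n + 1) - klScale klE0 n) < r)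
    (hM : β * (klScale klE0 n + t * (klScale klE0 (n + 1) - klScale klE0 n)) / (2 * Real.pi) + 1 ≤ M)
    {Mg ℓ r₁ : ℝ} (hr₁ : 0 < r₁)
    (hbd : ∀ s, |klWd (klScale klE0 n + t * (klScale klE0 (n + 1) - klScale klE0 n)) s *
      klPhi (klScale klE0 j) (klScale klE0 n + t * (klScale klE0 (n + 1) - klScale klE0 n)) s| ≤ Mg)
    (hlip : ∀ s s', |klWd (klScale klE0 n + t * (klScale klE0 (n + 1) - klScale klE0 n)) s *
        klPhi (klScale klE0 j) (klScale klE0 n + t * (klScale klE0 (n + 1) - klScale klE0 n)) s -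
      klWd (klScale klE0 n + t * (klScale klE0 (n + 1) - klScale klE0 n)) s' *
        klPhi (klScale klE0 j) (klScale klE0 n + t * (klScale klE0 (n + 1) - klScale klE0 n)) s'| ≤ ℓ * |s - s'|)
    (hin : ∀ s, s ≤ r₁ ^ 2 → klWd (klScale klE0 n + t * (klScale klE0 (n + 1) - klScale klE0 n)) s *
      klPhi (klScale klE0 j) (klScale klE0 n + t * (klScale klE0 (n + 1) - klScale klE0 n)) s = 0)
    (hout : ∀ s, (klScale klE0 n + t * (klScale klE0 (n + 1) - klScale klE0 n)) ^ 2 ≤ s →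
      klWd (klScale klE0 n + t * (klScale klE0 (n + 1) - klScale klE0 n)) s *
        klPhi (klScale klE0 j) (klScale klE0 n + t * (klScale klE0 (n + 1) - klScale klE0 n)) s = 0)
    (F : FreqMomentum L M → Fin 2 → FreqMomentum L M → ℂ)
    -- the reference field and its window profile on the hard shell
    (V₀ : FreqMomentum L M → Fin 2 → ℂ) {ε : ℝ} (hε0 : 0 ≤ ε) {m : ℕ} (cen : Fin m → TorusSite 2 L) (ρw Aw : Fin m → ℝ) (hρw : ∀ w, 0 ≤ ρw w) (hAw : ∀ w, 0 ≤ Aw w)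
    (hδ : ∀ p : FreqMomentum L M, ∀ σ : Fin 2, Wd t p ≠ 0 →
      ‖F p σ p - V₀ p σ‖ ≤ ε + ∑ w : Fin m, if klTorusNorm L (p.2 - cen w) ≤ ρw w then Aw w else 0)
    -- the angular weights of the reference field's spin sum
    (w₁ w₂ : ℝ × ℝ → ℝ) (v₁ v₂ : ℝ → ℝ) (hvm₁ : Measurable v₁) (hvm₂ : Measurable v₂) (hvp₁ : Function.Periodic v₁ (2 * π)) (hvp₂ : Function.Periodic v₂ (2 * π))
    {Bv : ℝ} (hvb₁ : ∀ ϑ, |v₁ ϑ| ≤ Bv) (hvb₂ : ∀ ϑ, |v₂ ϑ| ≤ Bv)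
    (hw₁ : ∀ p : ℝ × ℝ, p.1 ∈ Ioo (-r) r → w₁ (levelChart μ K p) = v₁ p.2) (hw₂ : ∀ p : ℝ × ℝ, p.1 ∈ Ioo (-r) r → w₂ (levelChart μ K p) = v₂ p.2)
    (hwc₁ : Continuous w₁) (hwc₂ : Continuous w₂) (hw1₁ : ∀ x y, w₁ (x + 2 * π, y) = w₁ (x, y)) (hw2₁ : ∀ x y, w₁ (x, y + 2 * π) = w₁ (x, y))
    (hw1₂ : ∀ x y, w₂ (x + 2 * π, y) = w₂ (x, y)) (hw2₂ : ∀ x y, w₂ (x, y + 2 * π) = w₂ (x, y))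
    {Lw Bw : ℝ} (hLw : 0 ≤ Lw) (hwlip₁ : ∀ p q : ℝ × ℝ, |w₁ p - w₁ q| ≤ Lw * dist p q) (hwlip₂ : ∀ p q : ℝ × ℝ, |w₂ p - w₂ q| ≤ Lw * dist p q)
    (hwb₁ : ∀ p, |w₁ p| ≤ Bw) (hwb₂ : ∀ p, |w₂ p| ≤ Bw)
    (hV : ∀ p : FreqMomentum L M, ∑ s : Fin 2, V₀ p s =
      ((w₁ (latticeMomentum L p.2 0, latticeMomentum L p.2 1) : ℝ) : ℂ) + ((w₂ (latticeMomentum L p.2 0, latticeMomentum L p.2 1) : ℝ) : ℂ) * Complex.I)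
    (c : ℤ) (x : TorusSite 2 L) :
    (klScale klE0 n - klScale klE0 (n + 1)) * ((β * (L : ℝ) ^ 2) ^ 3)⁻¹ *
      ‖∑ p : FreqMomentum L M, ∑ σ : Fin 2, ∑ p' : FreqMomentum L M,
        (if matsubaraInt M p'.1 + c = matsubaraInt M p.1 + c ∧ p'.2 = p.2 + x - x then
          (((((Φ j t p) : ℝ) : ℂ) * (((β * (L : ℝ) ^ 2 : ℝ) : ℂ) * propCT L M β μ K p)) * ((((Wd t p') : ℝ) : ℂ) * (((β * (L : ℝ) ^ 2 : ℝ) : ℂ) * propCT L M β μ K p')) +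
            ((((Wd t p) : ℝ) : ℂ) * (((β * (L : ℝ) ^ 2 : ℝ) : ℂ) * propCT L M β μ K p)) * ((((Φ j t p') : ℝ) : ℂ) * (((β * (L : ℝ) ^ 2 : ℝ) : ℂ) * propCT L M β μ K p'))) *
            F p σ p'
        else 0)‖ ≤
      2 * ((klScale klE0 n - klScale klE0 (n + 1)) * (2 *
        (((2 * π) ^ 2)⁻¹ * (Bv * (2 * π * (π * Real.sqrt 2 / (B.Dtmin - 2 * A)) *
              ((2 * (klScale klE0 n + t * (klScale klE0 (n + 1) - klScale klE0 n)) * (2 * (klScale klE0 n + t * (klScale klE0 (n + 1) - klScale klE0 n)) *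
                (2 * (klScale klE0 n + t * (klScale klE0 (n + 1) - klScale klE0 n)) ^ 2 * (ℓ / r₁ ^ 4 + 2 * Mg / r₁ ^ 6) + (ℓ / r₁ ^ 2 + Mg / r₁ ^ 4)))) *
                ((klScale klE0 n + t * (klScale klE0 (n + 1) - klScale klE0 n)) + 2 * Real.pi / β) / β) +
            β⁻¹ * (((klScale klE0 n + t * (klScale klE0 (n + 1) - klScale klE0 n)) * β / π + 1) *
              (2 * (klScale klE0 n + t * (klScale klE0 (n + 1) - klScale klE0 n)) *
                (2 * π * (1 / (B.Dtmin - 2 * A) ^ 2 + Real.pi * Real.sqrt 2 * (2 + 4 * A) / (B.Dtmin - 2 * A) ^ 3) *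
                  (klScale klE0 n + t * (klScale klE0 (n + 1) - klScale klE0 n)) * (Mg / r₁ ^ 2)))))) +
          ((klScale klE0 n + t * (klScale klE0 (n + 1) - klScale klE0 n)) / π + 3 / β) *
            (2 * π * (Bw * (2 * (klScale klE0 n + t * (klScale klE0 (n + 1) - klScale klE0 n)) *
              (2 * (klScale klE0 n + t * (klScale klE0 (n + 1) - klScale klE0 n)) ^ 2 * (ℓ / r₁ ^ 4 + 2 * Mg / r₁ ^ 6) + (ℓ / r₁ ^ 2 + Mg / r₁ ^ 4)) *
              (4 + 2 * A)) + Lw * (Mg / r₁ ^ 2)) / L))) +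
        ((2 : ℝ) ^ 10 * 15367 * ε + ∑ w : Fin m, (2 : ℝ) ^ 10 * 15381 * (ρw w / π + ((L : ℝ))⁻¹) * Aw w)) := by
  have h10 := (klmf_klScale_succ_pos_le n).2
  have hdiff : 0 ≤ klScale klE0 n - klScale klE0 (n + 1) := by linarith
  have hβ0' : 0 < β := pos_of_klBetaMin_le hβ
  have hprof := klph_phValue_row_profile_ref_le (L := L) (M := M) hK hβ hβL n ht Φ hΦ Wd hWd hj (fun p σ => F p σ p) V₀ hε0 cen ρw Aw hρw hAw hδ
  have hrotw := klpw_phValue_row_weighted_le (L := L) (M := M) B hA hADt hlo hhi hβ0' n ht Φ hΦ Wd hWd j hΛr hM hr₁ hbd hlip hin hout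
    w₁ w₂ v₁ v₂ hvm₁ hvm₂ hvp₁ hvp₂ hvb₁ hvb₂ hw₁ hw₂ hwc₁ hwc₂ hw1₁ hw2₁ hw1₂ hw2₂ hLw hwlip₁ hwlip₂ hwb₁ hwb₂ V₀ hV
  have hmod := hprof.trans (add_le_add (add_le_add hrotw le_rfl) le_rfl)
  rw [klph_directRow_diag_eq β μ K (Φ j t) (Wd t) F c x, norm_mul, Complex.norm_ofNat]
  have hre : (klScale klE0 n - klScale klE0 (n + 1)) * ((β * (L : ℝ) ^ 2) ^ 3)⁻¹ *
        (2 * ‖∑ p : FreqMomentum L M, ∑ σ : Fin 2,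
          (((((Wd t p) : ℝ) : ℂ) * (((β * (L : ℝ) ^ 2 : ℝ) : ℂ) * propCT L M β μ K p)) * ((((Φ j t p) : ℝ) : ℂ) * (((β * (L : ℝ) ^ 2 : ℝ) : ℂ) * propCT L M β μ K p))) *
            F p σ p‖) =
      2 * ((klScale klE0 n - klScale klE0 (n + 1)) * ((β * (L : ℝ) ^ 2) ^ 3)⁻¹ *
        ‖∑ p : FreqMomentum L M, ∑ σ : Fin 2,
          (((((Wd t p) : ℝ) : ℂ) * (((β * (L : ℝ) ^ 2 : ℝ) : ℂ) * propCT L M β μ K p)) * ((((Φ j t p) : ℝ) : ℂ) * (((β * (L : ℝ) ^ 2 : ℝ) : ℂ) * propCT L M β μ K p))) *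
            F p σ p‖) := by ring
  rw [hre]
  linarith


end DiagWeighted

end Summit.HubbardSuperconductivity.HubbardSuperconductivity.Theorems.KLRegimeSplit

end
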